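import Mathlib
import Summits.Ventures.HodgeRepro.Tier4.Line4.CharacterPairCons

/-!
# Tier4/Line4/CharacterPairFull — the (B) row of the wall as ONE theorem: the PAIR `(chi, chi′)` with all twelve
character binders of `mixed_two_torus` on the seesaw plane, from the integers, modulo the print and `hagree`
(C-L4-B-EXTEND, part 8)

Blind re-derivation cell `pub-hodge-repro`, Tier 4 «prove the step» (README §9–§10), seat t4-x2 (reserve
wall-breaker, gen 6; GO S16576).  Tree path `lean/Summits/Ventures/HodgeRepro/Tier4/Line4/CharacterPairFull.lean`.
Imports: Mathlib + `Tier4/Line4/CharacterPairCons` (and through it the whole chain parts 1–7).  No definition, no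
instance, no printed theorem proved.

* **`exists_wall_character_pair_seesaw_of_agree`** — on LINE L4's seesaw plane, for any integers `eP eM eP′ eM′`
  whose weight characters agree on `T_∞ ∩ T′_∞` (`hagree`), there are `chi : T(𝔸) → ℂ` and `chi′ : T′(𝔸) → ℂ` with
  the wall's `chi_mul`, `chi_rational`, `hc`, `hu`, `_hchi`; `chi'_mul`, `chi'_rational`, `hc'`, `_hunit'`, `_hchi'`;
  and `chi_centre` (N2) — part 3a's `chi` and part 7's `chi′`, modulo the print [DE14] Cor. 3.6.2 on `T(k)\T(𝔸)`
  (`hDE`) and on `T′(k)\T′(𝔸)` (`hDE'`) and p723452's `hcl`/`hbot` (binders).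
Nothing here says anything about the status of the Hodge conjecture for CM abelian varieties, which is NOT proved;
HC_CM is NOT proved by anyone in this repository.
-/

set_option autoImplicit false

noncomputable section

namespace Summit.Ventures.HodgeRepro.Tier4.Line4

open NumberField Matrix Summit.Ventures.HodgeRepro.Tier4.Common Summit.Ventures.HodgeRepro.Tier4.Line1
  Summit.Ventures.HodgeRepro.Tier4.Lit

section Full

variable {k : Type} [Field k] [NumberField k] (q : QuadData k) (a : Fin 4 → k)
  (g g' : Matrix (Fin 4) (Fin 4) k) (hgg' : g * g' = 1) (hg'g : g' * g = 1)
  (hgΩ : g * (PlaneData.mixedRow q (a 0) (a 2)).Ω = (PlaneData.mixedRow q (a 0) (a 2)).Ω * g)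
  (lam : k) (hlam : lam ≠ 0)
  (hiso : g * (PlaneData.mixedRow q (a 1) (a 3)).B * gᵀ = lam • (PlaneData.mixedRow q (a 0) (a 2)).B)

include lam hlam hiso in
/-- **THE (B) ROW AS ONE THEOREM**: the wall's PAIR of characters with all twelve character binders, from the integers
`(eP, eM, eP′, eM′)` whose weight characters agree on `T_∞ ∩ T′_∞`, modulo the print (twice) and p723452's
`hcl`/`hbot`. -/
theorem exists_wall_character_pair_seesaw_of_agree (ht : q.t = 0) (hn : ¬ IsSquare (-q.n)) (ha : ∀ i, a i ≠ 0)
    (hreal : ∀ w : InfinitePlace k, w.IsReal) (hcm : ∀ w, IsCMAt q w)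
    (hA : IsAnisotropic ((PlaneData.mixedRow q (a 0) (a 2)).withTransportedTorus g g' hgg' hg'g hgΩ))
    [hcl : IsClosed ((rationalOf ((PlaneData.mixedRow q (a 0) (a 2)).withTransportedTorus g g' hgg' hg'g hgΩ)
      (torusT ((PlaneData.mixedRow q (a 0) (a 2)).withTransportedTorus g g' hgg' hg'g hgΩ)) :
      Subgroup (torusT ((PlaneData.mixedRow q (a 0) (a 2)).withTransportedTorus g g' hgg' hg'g hgΩ))) :
      Set (torusT ((PlaneData.mixedRow q (a 0) (a 2)).withTransportedTorus g g' hgg' hg'g hgΩ)))]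
    (hbot : rationalOf ((PlaneData.mixedRow q (a 0) (a 2)).withTransportedTorus g g' hgg' hg'g hgΩ)
      (torusT ((PlaneData.mixedRow q (a 0) (a 2)).withTransportedTorus g g' hgg' hg'g hgΩ)) ⊓
      torusInf ((PlaneData.mixedRow q (a 0) (a 2)).withTransportedTorus g g' hgg' hg'g hgΩ) = ⊥)
    (hDE : letI : CommGroup (torusT ((PlaneData.mixedRow q (a 0) (a 2)).withTransportedTorus g g' hgg' hg'g hgΩ)) :=
        { (inferInstance : Group (torusT ((PlaneData.mixedRow q (a 0) (a 2)).withTransportedTorus g g' hgg' hg'g hgΩ)))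
          with mul_comm := torusT_seesaw_mul_comm q a g g' hgg' hg'g hgΩ (ha 0) (ha 2) }
      haveI : CompactSpace (torusT ((PlaneData.mixedRow q (a 0) (a 2)).withTransportedTorus g g' hgg' hg'g hgΩ) ⧸
          rationalOf ((PlaneData.mixedRow q (a 0) (a 2)).withTransportedTorus g g' hgg' hg'g hgΩ)
            (torusT ((PlaneData.mixedRow q (a 0) (a 2)).withTransportedTorus g g' hgg' hg'g hgΩ))) :=
        compactSpace_quotient_of_cocompact _ (cocompact_rationalOf_torusT_of_anisotropic _
          (isGenuineRow_seesawPlane q ht hn a (ha 0) (ha 2) g g' hgg' hg'g hgΩ lam hlam hiso) hA)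
      DeitmarEchterhoff2014_Cor_3_6_2_restriction_surjective
        (torusT ((PlaneData.mixedRow q (a 0) (a 2)).withTransportedTorus g g' hgg' hg'g hgΩ) ⧸
          rationalOf ((PlaneData.mixedRow q (a 0) (a 2)).withTransportedTorus g g' hgg' hg'g hgΩ)
            (torusT ((PlaneData.mixedRow q (a 0) (a 2)).withTransportedTorus g g' hgg' hg'g hgΩ))))
    (hDE' : letI : CommGroup (torusT' ((PlaneData.mixedRow q (a 0) (a 2)).withTransportedTorus g g' hgg' hg'g hgΩ)) :=
        { (inferInstance : Group (torusT' ((PlaneData.mixedRow q (a 0) (a 2)).withTransportedTorus g g' hgg' hg'g hgΩ)))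
          with mul_comm := torusT'_seesaw_mul_comm q a g g' hgg' hg'g hgΩ lam hlam hiso (ha 1) (ha 3) }
      haveI : IsClosed ((rationalOf ((PlaneData.mixedRow q (a 0) (a 2)).withTransportedTorus g g' hgg' hg'g hgΩ)
          (torusT' ((PlaneData.mixedRow q (a 0) (a 2)).withTransportedTorus g g' hgg' hg'g hgΩ)) :
          Subgroup (torusT' ((PlaneData.mixedRow q (a 0) (a 2)).withTransportedTorus g g' hgg' hg'g hgΩ))) :
          Set (torusT' ((PlaneData.mixedRow q (a 0) (a 2)).withTransportedTorus g g' hgg' hg'g hgΩ))) :=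
        isClosed_rationalOf_torusT' _
      haveI : CompactSpace (torusT' ((PlaneData.mixedRow q (a 0) (a 2)).withTransportedTorus g g' hgg' hg'g hgΩ) ⧸
          rationalOf ((PlaneData.mixedRow q (a 0) (a 2)).withTransportedTorus g g' hgg' hg'g hgΩ)
            (torusT' ((PlaneData.mixedRow q (a 0) (a 2)).withTransportedTorus g g' hgg' hg'g hgΩ))) :=
        compactSpace_quotient_of_cocompact _ (cocompact_rationalOf_torusT'_of_anisotropic _
          (isGenuineRow_seesawPlane q ht hn a (ha 0) (ha 2) g g' hgg' hg'g hgΩ lam hlam hiso) hA)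
      DeitmarEchterhoff2014_Cor_3_6_2_restriction_surjective
        (torusT' ((PlaneData.mixedRow q (a 0) (a 2)).withTransportedTorus g g' hgg' hg'g hgΩ) ⧸
          rationalOf ((PlaneData.mixedRow q (a 0) (a 2)).withTransportedTorus g g' hgg' hg'g hgΩ)
            (torusT' ((PlaneData.mixedRow q (a 0) (a 2)).withTransportedTorus g g' hgg' hg'g hgΩ))))
    (eP eM eP' eM' : InfinitePlace k → ℤ)
    (hagree : ∀ t : GA ((PlaneData.mixedRow q (a 0) (a 2)).withTransportedTorus g g' hgg' hg'g hgΩ),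
      t ∈ torusT ((PlaneData.mixedRow q (a 0) (a 2)).withTransportedTorus g g' hgg' hg'g hgΩ) →
      t ∈ torusT' ((PlaneData.mixedRow q (a 0) (a 2)).withTransportedTorus g g' hgg' hg'g hgΩ) →
      t ∈ infinitePart ((PlaneData.mixedRow q (a 0) (a 2)).withTransportedTorus g g' hgg' hg'g hgΩ) →
      (∏ w : InfinitePlace k,
        (weightAt ((PlaneData.mixedRow q (a 0) (a 2)).withTransportedTorus g g' hgg' hg'g hgΩ) q w 0 t ^ (-(eP w)) *
          weightAt ((PlaneData.mixedRow q (a 0) (a 2)).withTransportedTorus g g' hgg' hg'g hgΩ) q w 1 t ^ (-(eM w)))) =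
        torusWeight' q a g g' hgg' hg'g hgΩ eP' eM' t) :
    ∃ chi : torusT ((PlaneData.mixedRow q (a 0) (a 2)).withTransportedTorus g g' hgg' hg'g hgΩ) → ℂ,
    ∃ chi' : torusT' ((PlaneData.mixedRow q (a 0) (a 2)).withTransportedTorus g g' hgg' hg'g hgΩ) → ℂ,
      (∀ s t, chi (s * t) = chi s * chi t) ∧
      (∀ t ∈ rationalOf ((PlaneData.mixedRow q (a 0) (a 2)).withTransportedTorus g g' hgg' hg'g hgΩ)
        (torusT ((PlaneData.mixedRow q (a 0) (a 2)).withTransportedTorus g g' hgg' hg'g hgΩ)), chi t = 1) ∧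
      Continuous chi ∧ (∀ t, ‖chi t‖ = 1) ∧
      (∀ w : InfinitePlace k, ChiMatchesAt ((PlaneData.mixedRow q (a 0) (a 2)).withTransportedTorus g g' hgg' hg'g hgΩ)
        q w (eP w) (eM w) chi) ∧
      (∀ s t, chi' (s * t) = chi' s * chi' t) ∧
      (∀ t ∈ rationalOf ((PlaneData.mixedRow q (a 0) (a 2)).withTransportedTorus g g' hgg' hg'g hgΩ)
        (torusT' ((PlaneData.mixedRow q (a 0) (a 2)).withTransportedTorus g g' hgg' hg'g hgΩ)), chi' t = 1) ∧
      Continuous chi' ∧ (∀ t, ‖chi' t‖ = 1) ∧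
      (∀ w : InfinitePlace k, ChiMatchesAt' ((PlaneData.mixedRow q (a 0) (a 2)).withTransportedTorus g g' hgg' hg'g hgΩ)
        q w g g' (eP' w) (eM' w) chi') ∧
      ∀ (z : GA ((PlaneData.mixedRow q (a 0) (a 2)).withTransportedTorus g g' hgg' hg'g hgΩ))
        (hz : z ∈ centre ((PlaneData.mixedRow q (a 0) (a 2)).withTransportedTorus g g' hgg' hg'g hgΩ)),
        chi ⟨z, centre_le_torusT _ hz⟩ = chi' ⟨z, centre_le_torusT' _ hz⟩ := by
  obtain ⟨chi, hmul, hrat, hcont, hunit, hchi⟩ :=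
    exists_wall_character_ktypes_seesaw q a g g' hgg' hg'g hgΩ ht hn ha lam hlam hiso hreal hcm hA hbot hDE eP eM
  obtain ⟨chi', hmul', hrat', hcont', hunit', hchi', hcentre⟩ :=
    exists_wall_character'_pair_seesaw_of_agree q a g g' hgg' hg'g hgΩ lam hlam hiso ht hn ha hreal hcm hA chi hmul hrat
      hcont hunit hDE' eP eM eP' eM' hchi hagree
  exact ⟨chi, chi', hmul, hrat, hcont, hunit, hchi, hmul', hrat', hcont', hunit', hchi', hcentre⟩

end Full

end Summit.Ventures.HodgeRepro.Tier4.Line4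

end
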